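import Summits.HodgeConjecture.HodgeConjecture.Theorems.VHCAbelianSchemesRoadWeilLineThroughAnchor
import Summits.HodgeConjecture.HodgeConjecture.Theorems.Ring2AbelianAllOneSplitWeilAnchorCarrierDefs
import Summits.HodgeConjecture.HodgeConjecture.Theorems.Ring2AbelianAllOneSplitWeilAnchorLattice
import Summits.HodgeConjecture.HodgeConjecture.Theorems.Ring2AbelianAllCMAlgebraicCarriersDefs
import Summits.HodgeConjecture.HodgeConjecture.Theorems.Ring2AbelianAllWeilHyperbolicDescent
import Literature.AlgebraicGeometry.Deligne1982.WeilTypeCMQuadratic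
import Literature.AlgebraicGeometry.HodgeTheory.WeilClassesOfIsogenyTransportOfStructure
import Literature.AlgebraicGeometry.Motives.AimedSplitProductProofs
import HarnessLib

/-!
# Ring 2 / AbelianAll (André column) — THE QUADRATIC TYPES PER FIELD: generator monotonicity of the one-anchor node, field invariance of the
# per-field node, and the rows of PART AF for an ARBITRARY door `𝒪` from the field-wise node (route-free)

research route, not a corollary; conditional on HC_CM plus one named minimal statement.

ROUTE-FREE (imports no `Theses.VHCAbelianSchemesRoad`; theorems only, no definition, no new named fact; `HC_CM` occurs only as a CONCLUSION). PART AG.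
The one-anchor node of PART AF, `OneSplitWeilAnchorChartCarriers 𝒪 R e₀ p`, is typed by the minimal polynomial `R(T²)` of the anchor's generator `η₀`; for an
imaginary quadratic field (`e₀ = 1`, `R = T + r`) this asks `η₀² = −r` ON THE NOSE, while print's anchor (Markman's secant quotient at level `d = 4r`) has
`ψ_Y² = −(4r+1)²·4r` — same field `ℚ(√−r)`, other generator. This file proves that the generator is not content and runs the André column on the per-FIELD node
`QuadraticFieldOneSplitWeilAnchorChartCarriers 𝒪 r p := ∃ m ≥ 1, OneSplitWeilAnchorChartCarriers 𝒪 (T + m²r) 1 p` (Defs §3):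

* §1 `splitQuadraticWeilDatum_nsmul` — a split `ℚ(√−r)`-datum `(B, η, e, a)` of type `(T + r, 1, p)` (André's `(*)`: `IsWeilTypeCM`, `η`-compatible hyperplane class,
  split frame) is, for every `m ≥ 1`, a split datum `(B, m·η, e, a)` of type `(T + m²r, 1, p)` with the SAME Weil space (van Geemen 4.9; `IsWeilTypeCM.quadratic_nsmul`,
  `weilClassesOf_nsmul_eq_of_sq`, `isHyperbolicWeilType_natCast_zsmul_iff`); hence GENERATOR MONOTONICITY of both one-anchor nodes:
  `OneSplitWeilAnchorCarriers 𝒪 (T + s) 1 p → OneSplitWeilAnchorCarriers 𝒪 (T + n²s) 1 p` and the same for the chart node (same anchor, generator `n·η₀`).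
* §2 the per-field node: implied by the typed node (`m = 1`); FIELD INVARIANCE `QF 𝒪 (n²r) p ↔ QF 𝒪 r p` (`n ≥ 1`); door monotonicity of `carriedClasses`, of the typed
  and per-field nodes and of the `∀`-types nodes (`𝒪 ≤ 𝒪′`); `OneSplitWeilAnchorChartCarriersAll 𝒪 → OneSplitWeilAnchorFieldChartCarriersAll 𝒪`; the hard-wired twisted
  nodes of §1–§2 of the Defs file ARE the generic ones at `twistedReflexiveClass C AdmTw` (`Iff.rfl`-level bookkeeping).
* §3 ROWS FOR AN ARBITRARY DOOR `𝒪` from the per-field ∕ field-wise node: `W(B) ⊗ ℂ ≤ algebraicClasses B.X p` for EVERY split target of EVERY type `T + r` ⟸ door(`𝒪`) ∧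
  the family fact `andre1996_weilLineFamily_throughSplitAnchor` ∧ `QF 𝒪 r p` (rescale the target to the anchor's type `T + m²r`, run the chart engine);
  **`AndreSplitWeilClasses ⟸ door(𝒪) ∧ fact ∧ OneSplitWeilAnchorFieldChartCarriersAll 𝒪`**; **`HC_CM ⟸` + Kodaira** (Lemme 6.3.2 = CorCM kernel theorem);
  **`(∀ A, HodgeConjectureFor A) ⟸` + Lemme 6.3.1 + `CMAlgebraicCarriers 𝒪`** (`HC_CM` idle) — the André column's `B_min` of gen 64 for the door `𝒪`, instantiated at the
  route's PRIMED door in the companion leaf `Ring2AbelianAllOneSplitWeilAnchorPrime`.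

HONEST: every carrier node is OPEN (the per-field `(6,3)` cell is served by print's pinned claim L1″, PREPRINT — companion leaf), NOT implied by the Hodge conjecture;
the family fact, Kodaira and Lemme 6.3.1 enter BY NAME. Nothing here says any node, door, Weil class, `HC_CM`, `HC_AV` or HC holds.
References: [cite: vanGeemen1994HodgeAV, 4.9 and Lemma 5.2 (2)] [cite: MoonenZarhin1999LowDim, (1.9)] [cite: Andre1996Motifs, §6.3 a)–c), Lemmes 6.3.1–6.3.3 (pp. 31–33)]
[cite: Andre1992HodgeCM, Théorème] [cite: Deligne1982HodgeCycles, §4 proof of Thm. 4.8 (clauses (a)–(c)), Prop. 4.4] [cite: MoonenZarhin1998WeilClasses, §1]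
[cite: Markman2025SecantWeil, §1.5 (p. 7) and Thm. 1.4.1] [cite: Bloch1972Semiregularity, Remark (7.5)] [cite: Huybrechts2005, Prop. 5.3.1, Cor. 5.3.3] [cite: Milne1999, §7 p. 72].
-/

noncomputable section

open CategoryTheory CategoryTheory.Limits AlgebraicGeometry Topology

namespace Summit.HodgeConjecture.HodgeConjecture.Ring2.AbelianAll

-- the cell's namespace repeats the summit name (`Summit.HodgeConjecture.HodgeConjecture…`), as in every `Ring2*` file
set_option linter.dupNamespace false

open Literature.AlgebraicGeometry Literature.AlgebraicGeometry.Motives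
open Literature.AlgebraicGeometry.HodgeTheory
open Literature.AlgebraicGeometry.Deligne1982
open Literature.AlgebraicGeometry.VanGeemen1994 (pullbackOne)
open Literature.AlgebraicTopology.SingularHomology
open Literature.AlgebraicGeometry.Milne1999 (IsOfCMType CMHodgeHypothesisAt)
open Literature.AlgebraicGeometry.Andre1996 (andre1996_cmAnchoredPencil andre1996_weilLineFamily_throughSplitAnchor)
open Summit.Ventures.HSemireg (ObjClass LocalVariationalHodgeFor)
open Summit.HodgeConjecture.HodgeConjecture.Ring2.SemiregularRepresentatives (AnchoredCarrierAt
  weilClassesField_le_algebraicClasses_of_throughSplitAnchor_of_door_of_chartCarried cmHodgeHypothesisAt_of_kodaira_of_andreSplitWeilClasses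
  forall_hodgeConjectureFor_of_kodaira_of_andre1996_of_andreSplitWeilClasses_of_door_of_cmAlgebraic)

variable {𝒪 𝒪' : ObjClass} {p r s n : ℕ} {R : Polynomial ℤ} {e₀ : ℕ}

/-! ## §1 The generator of `ℚ(√−r)` is not content: rescaling split quadratic data and GENERATOR MONOTONICITY of the one-anchor nodes -/

section Rescale

variable {B : AbelianVariety ℂ} {η : B ⟶ B} {e : ProjectiveEmbedding B.X} {a : complexBetti (projectiveSpace e.n ℂ) 2}

/-- **Rescaling the generator of a split quadratic datum, every `E`-rank `2p`.** If `(B, η, e, a)` is a split `ℚ(√−r)`-Weil datum of type `(T + r, 1, p)` (André's `(*)`: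
`IsWeilTypeCM`, `η`-compatible hyperplane class `e^*a`, split frame), then for every `m ≥ 1` so is `(B, m·η, e, a)` of type `(T + m²r, 1, p)`, with the SAME Weil space
`W(B, m·η) = W(B, η)`: Weil type (`IsWeilTypeCM.quadratic_nsmul`), compatibility (`(mη)^* = m·η^*` on `H¹`), the frame (`η^*`-stable iff `(mη)^*`-stable), the Weil space
(`weilClassesOf_nsmul_eq_of_sq`). «Two generators of the same `K ⊂ End⁰(B)` define the same notion.» (The `p = 3` case is
`SemiregularRepresentatives.splitQuadraticDatum_nsmul`.) [cite: vanGeemen1994HodgeAV, 4.9 and Lemma 5.2 (2)] [cite: MoonenZarhin1999LowDim, (1.9)]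
[cite: Deligne1982HodgeCycles, §4 (4.3)–Prop. 4.4] -/
theorem splitQuadraticWeilDatum_nsmul (hB : IsWeilTypeCM B η (Polynomial.X + Polynomial.C (r : ℤ)) 1 p) {m : ℕ} (hm : 0 < m)
    (hRos : ∀ x y : complexBetti B.X 1,
      polarizationPairingOne B.X (complexBetti.map e.ι 2 a) (B.dim - 1) (pullbackOne B η x) y =
        -polarizationPairingOne B.X (complexBetti.map e.ι 2 a) (B.dim - 1) x (pullbackOne B η y))
    (hsplit : IsHyperbolicWeilType B η (p * 1) (complexBetti.map e.ι 2 a)) :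
    IsWeilTypeCM B (m • η) (Polynomial.X + Polynomial.C ((m ^ 2 * r : ℕ) : ℤ)) 1 p ∧
    (∀ x y : complexBetti B.X 1,
      polarizationPairingOne B.X (complexBetti.map e.ι 2 a) (B.dim - 1) (pullbackOne B (m • η) x) y =
        -polarizationPairingOne B.X (complexBetti.map e.ι 2 a) (B.dim - 1) x (pullbackOne B (m • η) y)) ∧
    IsHyperbolicWeilType B (m • η) (p * 1) (complexBetti.map e.ι 2 a) ∧
    weilClassesField B (m • η) ((Polynomial.X + Polynomial.C ((m ^ 2 * r : ℕ) : ℤ)).comp (Polynomial.X ^ 2)) (2 * p) =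
      weilClassesField B η ((Polynomial.X + Polynomial.C (r : ℤ)).comp (Polynomial.X ^ 2)) (2 * p) := by
  have hWT : IsWeilType B η p r := isWeilTypeCM_quadratic_iff.1 hB
  refine ⟨hB.quadratic_nsmul hm, fun x y ↦ ?_, ?_, ?_⟩
  · have hx : pullbackOne B (m • η) x = m • pullbackOne B η x := complexBetti_map_nsmul_deg_one m η x
    have hy : pullbackOne B (m • η) y = m • pullbackOne B η y := complexBetti_map_nsmul_deg_one m η y
    rw [hx, hy, map_nsmul, LinearMap.smul_apply, map_nsmul, hRos x y, smul_neg]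
  · rw [← natCast_zsmul]
    exact (isHyperbolicWeilType_natCast_zsmul_iff hm.ne').2 hsplit
  · rw [weilClassesField_X_add_C_comp_eq_weilClassesOf, weilClassesField_X_add_C_comp_eq_weilClassesOf]
    exact weilClassesOf_nsmul_eq_of_sq hWT.sq_eq hWT.d_pos hm p

end Rescale

/-- **GENERATOR MONOTONICITY of the `∃∀` node**: `OneSplitWeilAnchorCarriers 𝒪 (T + s) 1 p → OneSplitWeilAnchorCarriers 𝒪 (T + n²s) 1 p` for every `n ≥ 1` — same anchor
`X₀`, generator `n·η₀`, same hyperplane class, same carried class `w₀` (its Weil line is the same space). [cite: vanGeemen1994HodgeAV, 4.9]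
[cite: Bloch1972Semiregularity, Remark (7.5)] -/
theorem OneSplitWeilAnchorCarriers.quadratic_nsmul (h : OneSplitWeilAnchorCarriers 𝒪 (Polynomial.X + Polynomial.C (s : ℤ)) 1 p) (hn : 0 < n) :
    OneSplitWeilAnchorCarriers 𝒪 (Polynomial.X + Polynomial.C ((n ^ 2 * s : ℕ) : ℤ)) 1 p := by
  obtain ⟨X₀, η₀, e', a', w₀, hX₀, ha', ha'₀, hRos₀, hsplit₀, hw₀W, hw₀Q, hw₀0, hcar⟩ := h
  obtain ⟨hX₀', hRos₀', hsplit₀', hW'⟩ := splitQuadraticWeilDatum_nsmul hX₀ hn hRos₀ hsplit₀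
  exact ⟨X₀, n • η₀, e', a', w₀, hX₀', ha', ha'₀, hRos₀', hsplit₀', by rw [hW']; exact hw₀W, hw₀Q, hw₀0, hcar⟩

/-- **GENERATOR MONOTONICITY of the chart (`∀∃`) node**: `OneSplitWeilAnchorChartCarriers 𝒪 (T + s) 1 p → OneSplitWeilAnchorChartCarriers 𝒪 (T + n²s) 1 p` for every
`n ≥ 1` (same anchor, generator `n·η₀`; the chart clause only sees the Weil space). [cite: vanGeemen1994HodgeAV, 4.9] [cite: Bloch1972Semiregularity, Remark (7.5)] -/
theorem OneSplitWeilAnchorChartCarriers.quadratic_nsmul (h : OneSplitWeilAnchorChartCarriers 𝒪 (Polynomial.X + Polynomial.C (s : ℤ)) 1 p) (hn : 0 < n) :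
    OneSplitWeilAnchorChartCarriers 𝒪 (Polynomial.X + Polynomial.C ((n ^ 2 * s : ℕ) : ℤ)) 1 p := by
  obtain ⟨X₀, η₀, e', a', hX₀, ha', ha'₀, hRos₀, hsplit₀, hcar⟩ := h
  obtain ⟨hX₀', hRos₀', hsplit₀', hW'⟩ := splitQuadraticWeilDatum_nsmul hX₀ hn hRos₀ hsplit₀
  refine ⟨X₀, n • η₀, e', a', hX₀', ha', ha'₀, hRos₀', hsplit₀', fun X ε θ c hc hεθ hθ ↦ ?_⟩
  obtain ⟨w, hwQ, hw0, hwW, hwc⟩ := hcar X ε θ c hc hεθ hθ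
  exact ⟨w, hwQ, hw0, by rw [hW']; exact hwW, hwc⟩

/-! ## §2 The per-field node: from the typed node, FIELD INVARIANCE, door monotonicity, and the field-wise `∀`-types node -/

/-- The typed node at `T + r` implies the per-field node of `ℚ(√−r)` (`m = 1`). [cite: Bloch1972Semiregularity, Remark (7.5)] -/
theorem quadraticFieldOneSplitWeilAnchorChartCarriers_of_oneSplitWeilAnchorChartCarriers
    (h : OneSplitWeilAnchorChartCarriers 𝒪 (Polynomial.X + Polynomial.C (r : ℤ)) 1 p) : QuadraticFieldOneSplitWeilAnchorChartCarriers 𝒪 r p :=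
  ⟨1, one_pos, by rw [one_pow, one_mul]; exact h⟩

/-- The `∃∀` typed node at `T + r` implies the per-field node of `ℚ(√−r)`. [cite: Bloch1972Semiregularity, Remark (7.5)] -/
theorem quadraticFieldOneSplitWeilAnchorChartCarriers_of_oneSplitWeilAnchorCarriers
    (h : OneSplitWeilAnchorCarriers 𝒪 (Polynomial.X + Polynomial.C (r : ℤ)) 1 p) : QuadraticFieldOneSplitWeilAnchorChartCarriers 𝒪 r p := by
  refine quadraticFieldOneSplitWeilAnchorChartCarriers_of_oneSplitWeilAnchorChartCarriers ?_
  obtain ⟨X₀, η₀, e', a', w₀, hX₀, ha', ha'₀, hRos₀, hsplit₀, hw₀W, hw₀Q, hw₀0, hcar⟩ := h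
  refine ⟨X₀, η₀, e', a', hX₀, ha', ha'₀, hRos₀, hsplit₀, fun X ε θ c hc hεθ hθ ↦
    ⟨complexBetti.map ε.inv (2 * p) w₀, hw₀Q.pullback _, fun h0 ↦ hw₀0 ?_, ?_, hcar X ε θ c hc hεθ hθ⟩⟩
  · rw [← ε.complexBetti_map_hom_map_inv (2 * p) w₀, h0, map_zero]
  · rw [ε.complexBetti_map_hom_map_inv]
    exact hw₀W

/-- **FIELD INVARIANCE, up**: `QF 𝒪 r p → QF 𝒪 (n²r) p` for `n ≥ 1` (generator monotonicity). [cite: vanGeemen1994HodgeAV, 4.9] -/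
theorem QuadraticFieldOneSplitWeilAnchorChartCarriers.mul_sq (h : QuadraticFieldOneSplitWeilAnchorChartCarriers 𝒪 r p) (hn : 0 < n) :
    QuadraticFieldOneSplitWeilAnchorChartCarriers 𝒪 (n ^ 2 * r) p := by
  obtain ⟨m, hm, hnode⟩ := h
  refine ⟨m, hm, ?_⟩
  have e : n ^ 2 * (m ^ 2 * r) = m ^ 2 * (n ^ 2 * r) := by ring
  rw [← e]
  exact hnode.quadratic_nsmul hn

/-- **FIELD INVARIANCE, down**: `QF 𝒪 (n²r) p → QF 𝒪 r p` for `n ≥ 1` (the anchor of type `T + m²n²r` has generator in the order `ℤ[mn√−r]`).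
[cite: vanGeemen1994HodgeAV, 4.9] -/
theorem QuadraticFieldOneSplitWeilAnchorChartCarriers.of_mul_sq (h : QuadraticFieldOneSplitWeilAnchorChartCarriers 𝒪 (n ^ 2 * r) p) (hn : 0 < n) :
    QuadraticFieldOneSplitWeilAnchorChartCarriers 𝒪 r p := by
  obtain ⟨m, hm, hnode⟩ := h
  refine ⟨m * n, Nat.mul_pos hm hn, ?_⟩
  have e : m ^ 2 * (n ^ 2 * r) = (m * n) ^ 2 * r := by ring
  rw [← e]
  exact hnode

/-- **The per-field node IS an invariant of the field `ℚ(√−r)`**: `QF 𝒪 (n²r) p ↔ QF 𝒪 r p` for every `n ≥ 1` (`r` and `n²r` present the same field).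
[cite: vanGeemen1994HodgeAV, 4.9] [cite: MoonenZarhin1999LowDim, (1.9)] -/
theorem quadraticFieldOneSplitWeilAnchorChartCarriers_mul_sq_iff (hn : 0 < n) :
    QuadraticFieldOneSplitWeilAnchorChartCarriers 𝒪 (n ^ 2 * r) p ↔ QuadraticFieldOneSplitWeilAnchorChartCarriers 𝒪 r p :=
  ⟨fun h ↦ h.of_mul_sq hn, fun h ↦ h.mul_sq hn⟩

/-! ### Door monotonicity (`𝒪 ≤ 𝒪′`: a bigger object class makes every carrier node easier) -/

/-- `carriedClasses` is monotone in the object class. [cite: Bloch1972Semiregularity, Remark (7.5)] -/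
theorem carriedClasses_mono (hle : ∀ n X I κ, 𝒪 n X I κ → 𝒪' n X I κ) {N : ℕ} {X : SchemeOver ℂ} {θ : complexBetti X 2} :
    carriedClasses 𝒪 N p X θ ⊆ carriedClasses 𝒪' N p X θ := by
  rintro w ⟨I, κ, a, c, hp, h𝒪, ha, hκp, hκq⟩
  exact ⟨I, κ, a, c, hp, hle _ _ _ _ h𝒪, ha, hκp, hκq⟩

/-- The chart node is monotone in the object class. [cite: Bloch1972Semiregularity, Remark (7.5)] -/
theorem OneSplitWeilAnchorChartCarriers.mono (hle : ∀ n X I κ, 𝒪 n X I κ → 𝒪' n X I κ) (h : OneSplitWeilAnchorChartCarriers 𝒪 R e₀ p) :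
    OneSplitWeilAnchorChartCarriers 𝒪' R e₀ p := by
  obtain ⟨X₀, η₀, e', a', hX₀, ha', ha'₀, hRos₀, hsplit₀, hcar⟩ := h
  refine ⟨X₀, η₀, e', a', hX₀, ha', ha'₀, hRos₀, hsplit₀, fun X ε θ c hc hεθ hθ ↦ ?_⟩
  obtain ⟨w, hwQ, hw0, hwW, hwc⟩ := hcar X ε θ c hc hεθ hθ
  exact ⟨w, hwQ, hw0, hwW, carriedClasses_mono hle hwc⟩

/-- The `∃∀` node is monotone in the object class. [cite: Bloch1972Semiregularity, Remark (7.5)] -/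
theorem OneSplitWeilAnchorCarriers.mono (hle : ∀ n X I κ, 𝒪 n X I κ → 𝒪' n X I κ) (h : OneSplitWeilAnchorCarriers 𝒪 R e₀ p) :
    OneSplitWeilAnchorCarriers 𝒪' R e₀ p := by
  obtain ⟨X₀, η₀, e', a', w₀, hX₀, ha', ha'₀, hRos₀, hsplit₀, hw₀W, hw₀Q, hw₀0, hcar⟩ := h
  exact ⟨X₀, η₀, e', a', w₀, hX₀, ha', ha'₀, hRos₀, hsplit₀, hw₀W, hw₀Q, hw₀0, fun X ε θ c hc hεθ hθ ↦
    carriedClasses_mono hle (hcar X ε θ c hc hεθ hθ)⟩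

/-- The per-field node is monotone in the object class. [cite: Bloch1972Semiregularity, Remark (7.5)] -/
theorem QuadraticFieldOneSplitWeilAnchorChartCarriers.mono (hle : ∀ n X I κ, 𝒪 n X I κ → 𝒪' n X I κ)
    (h : QuadraticFieldOneSplitWeilAnchorChartCarriers 𝒪 r p) : QuadraticFieldOneSplitWeilAnchorChartCarriers 𝒪' r p := by
  obtain ⟨m, hm, hnode⟩ := h
  exact ⟨m, hm, hnode.mono hle⟩

/-- The `∀`-types node is monotone in the object class. [cite: Bloch1972Semiregularity, Remark (7.5)] -/
theorem OneSplitWeilAnchorChartCarriersAll.mono (hle : ∀ n X I κ, 𝒪 n X I κ → 𝒪' n X I κ) (h : OneSplitWeilAnchorChartCarriersAll 𝒪) :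
    OneSplitWeilAnchorChartCarriersAll 𝒪' :=
  fun R e₀ p hp B η e a hB ha ha₀ hRos hsplit ↦ (h R e₀ p hp B η e a hB ha ha₀ hRos hsplit).mono hle

/-- The field-wise `∀`-types node is monotone in the object class. [cite: Bloch1972Semiregularity, Remark (7.5)] -/
theorem OneSplitWeilAnchorFieldChartCarriersAll.mono (hle : ∀ n X I κ, 𝒪 n X I κ → 𝒪' n X I κ) (h : OneSplitWeilAnchorFieldChartCarriersAll 𝒪) :
    OneSplitWeilAnchorFieldChartCarriersAll 𝒪' :=
  ⟨fun r p hp B η e a hB ha ha₀ hRos hsplit ↦ (h.1 r p hp B η e a hB ha ha₀ hRos hsplit).mono hle,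
    fun R e₀ p he hp B η e a hB ha ha₀ hRos hsplit ↦ (h.2 R e₀ p he hp B η e a hB ha ha₀ hRos hsplit).mono hle⟩

/-- The two quadratic cells per field are monotone in the object class. [cite: Bloch1972Semiregularity, Remark (7.5)] -/
theorem QuadraticFieldSplitSixfoldAnchorOneCarrier.mono (hle : ∀ n X I κ, 𝒪 n X I κ → 𝒪' n X I κ) (h : QuadraticFieldSplitSixfoldAnchorOneCarrier 𝒪) :
    QuadraticFieldSplitSixfoldAnchorOneCarrier 𝒪' :=
  fun r hr ↦ (h r hr).mono hle

/-- (as above, `p = 4`) [cite: Bloch1972Semiregularity, Remark (7.5)] -/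
theorem QuadraticFieldSplitEightfoldAnchorOneCarrier.mono (hle : ∀ n X I κ, 𝒪 n X I κ → 𝒪' n X I κ) (h : QuadraticFieldSplitEightfoldAnchorOneCarrier 𝒪) :
    QuadraticFieldSplitEightfoldAnchorOneCarrier 𝒪' :=
  fun r hr ↦ (h r hr).mono hle

/-! ### The `∀`-types nodes: generic vs hard-wired twisted, typed vs field-wise -/

/-- The hard-wired twisted chart node of PART AF is the generic chart node at `twistedReflexiveClass C AdmTw`, every `C` (definitional bookkeeping). [folklore] -/
theorem oneSplitWeilAnchorChartTwistedCarriersAll_iff_forall :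
    OneSplitWeilAnchorChartTwistedCarriersAll ↔ ∀ C : ChernCharacterBetti, OneSplitWeilAnchorChartCarriersAll (twistedReflexiveClass C
      (fun n X₀ I E => Summit.Ventures.HSemireg.gluableSigmaAdmissible n X₀ I E ∨
        Literature.AlgebraicGeometry.HodgeTheory.bfSingleAdmissible n X₀ I E)) :=
  ⟨fun h C R e₀ p hp B η e a hB ha ha₀ hRos hsplit ↦ h R e₀ p hp B η e a hB ha ha₀ hRos hsplit C,
    fun h R e₀ p hp B η e a hB ha ha₀ hRos hsplit C ↦ h C R e₀ p hp B η e a hB ha ha₀ hRos hsplit⟩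

/-- **Typed ⟹ field-wise**: `OneSplitWeilAnchorChartCarriersAll 𝒪 → OneSplitWeilAnchorFieldChartCarriersAll 𝒪` (quadratic types: `m = 1`). So the André column's
carrier input SHRINKS again (gen 63 typed ⟹ gen 64 field-wise). [cite: vanGeemen1994HodgeAV, 4.9] [cite: Bloch1972Semiregularity, Remark (7.5)] -/
theorem oneSplitWeilAnchorFieldChartCarriersAll_of_oneSplitWeilAnchorChartCarriersAll (h : OneSplitWeilAnchorChartCarriersAll 𝒪) :
    OneSplitWeilAnchorFieldChartCarriersAll 𝒪 :=
  ⟨fun _ p hp B η e a hB ha ha₀ hRos hsplit ↦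
      quadraticFieldOneSplitWeilAnchorChartCarriers_of_oneSplitWeilAnchorChartCarriers (h _ 1 p hp B η e a hB ha ha₀ hRos hsplit),
    fun R e₀ p _ hp B η e a hB ha ha₀ hRos hsplit ↦ h R e₀ p hp B η e a hB ha ha₀ hRos hsplit⟩

/-- The cells feed the field-wise node's quadratic conjunct at `p = 3`, `4` (an inhabitant forces `r ≥ 1`). [cite: Deligne1982HodgeCycles, §4 p. 30] -/
theorem quadraticFieldOneSplitWeilAnchorChartCarriers_of_cell_of_isWeilTypeCM {B : AbelianVariety ℂ} {η : B ⟶ B}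
    (h3 : QuadraticFieldSplitSixfoldAnchorOneCarrier 𝒪) (hB : IsWeilTypeCM B η (Polynomial.X + Polynomial.C (r : ℤ)) 1 3) :
    QuadraticFieldOneSplitWeilAnchorChartCarriers 𝒪 r 3 :=
  h3 r (isWeilTypeCM_quadratic_iff.1 hB).d_pos

/-- (as above, `p = 4`) [cite: Deligne1982HodgeCycles, §4 p. 30] -/
theorem quadraticFieldOneSplitWeilAnchorChartCarriers_of_cell_of_isWeilTypeCM_four {B : AbelianVariety ℂ} {η : B ⟶ B}
    (h4 : QuadraticFieldSplitEightfoldAnchorOneCarrier 𝒪) (hB : IsWeilTypeCM B η (Polynomial.X + Polynomial.C (r : ℤ)) 1 4) :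
    QuadraticFieldOneSplitWeilAnchorChartCarriers 𝒪 r 4 :=
  h4 r (isWeilTypeCM_quadratic_iff.1 hB).d_pos

/-! ## §3 The rows of PART AF for an ARBITRARY door `𝒪` from the per-field ∕ field-wise node -/

section Rows

variable {B : AbelianVariety ℂ} {η : B ⟶ B} {e : ProjectiveEmbedding B.X} {a : complexBetti (projectiveSpace e.n ℂ) 2}

/-- **`W(B) ⊗ ℂ` algebraic for EVERY split `ℚ(√−r)`-target of type `(T + r, 1, p)`, `p > 1` ⟸ the door for `𝒪` ∧ the family fact ∧ the PER-FIELD node `QF 𝒪 r p`**: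
take the anchor of type `T + m²r`, RESCALE THE TARGET to that type (`η ↦ m·η`: same hyperplane class, same frame, same Weil space — §1) and run the chart engine
`weilClassesField_le_algebraicClasses_of_throughSplitAnchor_of_door_of_chartCarried`. [cite: Andre1996Motifs, proof of Lemme 6.3.3 (p. 33)]
[cite: Deligne1982HodgeCycles, §4 proof of Thm. 4.8] [cite: vanGeemen1994HodgeAV, 4.9] [cite: Bloch1972Semiregularity, Remark (7.5)] -/
theorem weilClassesField_le_algebraicClasses_of_split_of_throughSplitAnchor_of_door_of_quadraticField (h : andre1996_weilLineFamily_throughSplitAnchor)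
    (hT : LocalVariationalHodgeFor 𝒪) (hQ : QuadraticFieldOneSplitWeilAnchorChartCarriers 𝒪 r p) (hp : 1 < p)
    (hB : IsWeilTypeCM B η (Polynomial.X + Polynomial.C (r : ℤ)) 1 p) (ha : IsRationalClass a) (ha₀ : a ≠ 0)
    (hRos : ∀ x y : complexBetti B.X 1,
      polarizationPairingOne B.X (complexBetti.map e.ι 2 a) (B.dim - 1) (pullbackOne B η x) y =
        -polarizationPairingOne B.X (complexBetti.map e.ι 2 a) (B.dim - 1) x (pullbackOne B η y))
    (hsplit : IsHyperbolicWeilType B η (p * 1) (complexBetti.map e.ι 2 a)) :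
    weilClassesField B η ((Polynomial.X + Polynomial.C (r : ℤ)).comp (Polynomial.X ^ 2)) (2 * p) ≤ algebraicClasses B.X p := by
  obtain ⟨m, hm, X₀, η₀, e', a', hX₀, ha', ha'₀, hRos₀, hsplit₀, hcar⟩ := hQ
  obtain ⟨hB', hRos', hsplit', hW'⟩ := splitQuadraticWeilDatum_nsmul hB hm hRos hsplit
  rw [← hW']
  exact weilClassesField_le_algebraicClasses_of_throughSplitAnchor_of_door_of_chartCarried h hT hp hX₀ ha' ha'₀ hRos₀ hsplit₀ hcar hB' ha ha₀ hRos' hsplit'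

/-- **The `(6,3)` sector per field**: the door for `𝒪` ∧ the family fact ∧ `QuadraticFieldSplitSixfoldAnchorOneCarrier 𝒪` ⟹ `W(B) ⊗ ℂ ≤ algebraicClasses B.X 3` for EVERY
split Weil sixfold `(B, η, e, a)`, every imaginary quadratic type `T + r`. [cite: Markman2025SecantWeil, Thm. 1.5.1] [cite: Andre1996Motifs, proof of Lemme 6.3.3 (p. 33)] -/
theorem weilClassesField_le_algebraicClasses_splitSixfold_of_door_of_quadraticFieldCell (h : andre1996_weilLineFamily_throughSplitAnchor)
    (hT : LocalVariationalHodgeFor 𝒪) (h3 : QuadraticFieldSplitSixfoldAnchorOneCarrier 𝒪) (hB : IsWeilTypeCM B η (Polynomial.X + Polynomial.C (r : ℤ)) 1 3)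
    (ha : IsRationalClass a) (ha₀ : a ≠ 0)
    (hRos : ∀ x y : complexBetti B.X 1,
      polarizationPairingOne B.X (complexBetti.map e.ι 2 a) (B.dim - 1) (pullbackOne B η x) y =
        -polarizationPairingOne B.X (complexBetti.map e.ι 2 a) (B.dim - 1) x (pullbackOne B η y))
    (hsplit : IsHyperbolicWeilType B η (3 * 1) (complexBetti.map e.ι 2 a)) :
    weilClassesField B η ((Polynomial.X + Polynomial.C (r : ℤ)).comp (Polynomial.X ^ 2)) (2 * 3) ≤ algebraicClasses B.X 3 :=
  weilClassesField_le_algebraicClasses_of_split_of_throughSplitAnchor_of_door_of_quadraticField h hT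
    (quadraticFieldOneSplitWeilAnchorChartCarriers_of_cell_of_isWeilTypeCM h3 hB) (by norm_num) hB ha ha₀ hRos hsplit

/-- **The `(8,4)` sector per field**: the door for `𝒪` ∧ the family fact ∧ `QuadraticFieldSplitEightfoldAnchorOneCarrier 𝒪` ⟹ `W(B) ⊗ ℂ ≤ algebraicClasses B.X 4` for EVERY
split Weil eightfold, every imaginary quadratic type `T + r` (rung R2₈ in André's format). [cite: Markman2025SecantWeil, §1.2] [cite: Andre1996Motifs, proof of Lemme 6.3.3 (p. 33)] -/
theorem weilClassesField_le_algebraicClasses_splitEightfold_of_door_of_quadraticFieldCell (h : andre1996_weilLineFamily_throughSplitAnchor)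
    (hT : LocalVariationalHodgeFor 𝒪) (h4 : QuadraticFieldSplitEightfoldAnchorOneCarrier 𝒪) (hB : IsWeilTypeCM B η (Polynomial.X + Polynomial.C (r : ℤ)) 1 4)
    (ha : IsRationalClass a) (ha₀ : a ≠ 0)
    (hRos : ∀ x y : complexBetti B.X 1,
      polarizationPairingOne B.X (complexBetti.map e.ι 2 a) (B.dim - 1) (pullbackOne B η x) y =
        -polarizationPairingOne B.X (complexBetti.map e.ι 2 a) (B.dim - 1) x (pullbackOne B η y))
    (hsplit : IsHyperbolicWeilType B η (4 * 1) (complexBetti.map e.ι 2 a)) :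
    weilClassesField B η ((Polynomial.X + Polynomial.C (r : ℤ)).comp (Polynomial.X ^ 2)) (2 * 4) ≤ algebraicClasses B.X 4 :=
  weilClassesField_le_algebraicClasses_of_split_of_throughSplitAnchor_of_door_of_quadraticField h hT
    (quadraticFieldOneSplitWeilAnchorChartCarriers_of_cell_of_isWeilTypeCM_four h4 hB) (by norm_num) hB ha ha₀ hRos hsplit

end Rows

/-- **`AndreSplitWeilClasses ⟸ the door for 𝒪 ∧ the family fact ∧ OneSplitWeilAnchorFieldChartCarriersAll 𝒪`** (door-generic; quadratic types PER FIELD, higher CM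
fields per type): `p = 1` by Lefschetz `(1,1)`; `p ≥ 2`, `e₀ = 1`: `R = T + r` (`exists_eq_X_add_C_of_isWeilTypeCM_one'`) and the per-field row; `p ≥ 2`, `e₀ ≥ 2`: the
typed node and the chart engine. [cite: Andre1996Motifs, §6.3 b)–c) (pp. 32–33)] [cite: MoonenZarhin1998WeilClasses, §1] [cite: VoisinHodgeI2002, Thm. 11.30]
[cite: vanGeemen1994HodgeAV, 4.9] [cite: Bloch1972Semiregularity, Remark (7.5)] -/
theorem andreSplitWeilClasses_of_throughSplitAnchor_of_door_of_oneSplitWeilAnchorFieldChartCarriersAll (h : andre1996_weilLineFamily_throughSplitAnchor)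
    (hT : LocalVariationalHodgeFor 𝒪) (hall : OneSplitWeilAnchorFieldChartCarriersAll 𝒪) : AndreSplitWeilClasses := by
  intro B η R e₀ p e a hB ha ha₀ hRos hsplit w hw hwQ
  obtain _ | _ | p := p
  · exact absurd hB.k_pos (lt_irrefl 0)
  · exact lefschetzOneOne_rational_holds hB.isSmoothProjective w hwQ
      (hB.isOfHodgeType_of_mem_weilClassesField MoonenZarhin1998_weilClasses_hodgeCriterion_holds hw)
  · rcases Nat.lt_or_ge 1 e₀ with he | he
    · -- a CM field of degree `2e₀ ≥ 4`: the typed node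
      obtain ⟨X₀, η₀, e', a', hX₀, ha', ha'₀, hRos₀, hsplit₀, hcar⟩ := hall.2 R e₀ (p + 2) he (by omega) B η e a hB ha ha₀ hRos hsplit
      exact weilClassesField_le_algebraicClasses_of_throughSplitAnchor_of_door_of_chartCarried h hT (by omega) hX₀ ha' ha'₀ hRos₀ hsplit₀ hcar hB ha
        ha₀ hRos hsplit hw
    · -- an imaginary quadratic field: `R = T + r`, the per-field node
      obtain rfl : e₀ = 1 := le_antisymm he hB.e₀_pos
      obtain ⟨r, -, rfl⟩ := exists_eq_X_add_C_of_isWeilTypeCM_one' hB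
      exact weilClassesField_le_algebraicClasses_of_split_of_throughSplitAnchor_of_door_of_quadraticField h hT
        (hall.1 r (p + 2) (by omega) B η e a hB ha ha₀ hRos hsplit) (by omega) hB ha ha₀ hRos hsplit hw

/-- **`AndreSplitWeilClasses ⟸ the door for 𝒪 ∧ the family fact ∧ OneSplitWeilAnchorChartCarriersAll 𝒪`** (door-generic, typed `∀`-types node — PART AF's row with its
inline hypothesis NAMED). [cite: Andre1996Motifs, §6.3 b)–c) (pp. 32–33)] [cite: Deligne1982HodgeCycles, §4 proof of Thm. 4.8] [cite: Bloch1972Semiregularity, Remark (7.5)] -/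
theorem andreSplitWeilClasses_of_throughSplitAnchor_of_door_of_oneSplitWeilAnchorChartCarriersAll (h : andre1996_weilLineFamily_throughSplitAnchor)
    (hT : LocalVariationalHodgeFor 𝒪) (hall : OneSplitWeilAnchorChartCarriersAll 𝒪) : AndreSplitWeilClasses :=
  andreSplitWeilClasses_of_throughSplitAnchor_of_door_of_oneSplitWeilAnchorFieldChartCarriersAll h hT
    (oneSplitWeilAnchorFieldChartCarriersAll_of_oneSplitWeilAnchorChartCarriersAll hall)

/-- **`HC_CM ⟸ Kodaira ∧ the door for 𝒪 ∧ the family fact ∧ OneSplitWeilAnchorFieldChartCarriersAll 𝒪`** (door-generic; Lemme 6.3.2 = André 1992 is CorCM's KERNEL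
theorem; Kodaira turns its polarization classes into hyperplane classes). [cite: Andre1996Motifs, §6.3 Lemmes 6.3.2–6.3.3 (pp. 32–33)] [cite: Andre1992HodgeCM, Théorème]
[cite: Huybrechts2005, Prop. 5.3.1, Cor. 5.3.3] [cite: Milne1999, §7 p. 72] -/
theorem HC_CM_of_kodaira_of_throughSplitAnchor_of_door_of_oneSplitWeilAnchorFieldChartCarriersAll (hK : Kodaira1954_rationalKaehlerClass_eq_hyperplaneClass)
    (h : andre1996_weilLineFamily_throughSplitAnchor) (hT : LocalVariationalHodgeFor 𝒪) (hall : OneSplitWeilAnchorFieldChartCarriersAll 𝒪) :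
    Theses.RankFourFaces.CMAbelianHodge :=
  fun B hB' hcm ↦ cmHodgeHypothesisAt_of_kodaira_of_andreSplitWeilClasses hK
    (andreSplitWeilClasses_of_throughSplitAnchor_of_door_of_oneSplitWeilAnchorFieldChartCarriersAll h hT hall) B hB' hcm

/-- **`(∀ A, HodgeConjectureFor A) ⟸ Lemme 6.3.1 ∧ Kodaira ∧ the door for 𝒪 ∧ the family fact ∧ CMAlgebraicCarriers 𝒪 ∧ OneSplitWeilAnchorFieldChartCarriersAll 𝒪`** — THE
ANDRÉ COLUMN'S `B_min` OF GEN 64 FOR THE DOOR `𝒪` (`HC_CM` IDLE): besides the named theorems in print (Lemme 6.3.1, Kodaira, the André∕Deligne family fact) and the door,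
TWO carrier statements for `𝒪` — (i) `𝒪`-data modulo the `θ`-ray for KNOWN ALGEBRAIC classes (`2 ≤ p`, `2p + 4 ≤ n`) on polarised CM abelian `n`-folds; (ii) per inhabited
type `(E, p)`, `p ≥ 2` — PER FIELD when `E` is imaginary quadratic — ONE split anchor of our choice at whose every chart SOME non-zero rational `E`-Weil class carries an
`𝒪`-datum modulo the `θ`-ray. [cite: Andre1996Motifs, §6.3 (pp. 31–33)] [cite: Andre1992HodgeCM, Théorème] [cite: Deligne1982HodgeCycles, §4 proof of Thm. 4.8]
[cite: vanGeemen1994HodgeAV, 4.9] [cite: Bloch1972Semiregularity, Remark (7.5)] -/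
theorem forall_hodgeConjectureFor_of_kodaira_of_throughSplitAnchor_of_door_of_cmAlgebraic_of_fieldChartCarriersAll (h₂₁ : andre1996_cmAnchoredPencil)
    (hK : Kodaira1954_rationalKaehlerClass_eq_hyperplaneClass) (h : andre1996_weilLineFamily_throughSplitAnchor) (hT : LocalVariationalHodgeFor 𝒪)
    (hcm : CMAlgebraicCarriers 𝒪) (hall : OneSplitWeilAnchorFieldChartCarriersAll 𝒪) : ∀ A : AbelianVariety ℂ, HodgeConjectureFor A.dim A.X :=
  forall_hodgeConjectureFor_of_kodaira_of_andre1996_of_andreSplitWeilClasses_of_door_of_cmAlgebraic h₂₁ hK hT (fun n p h2 h4 ↦ hcm n p h2 h4)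
    (andreSplitWeilClasses_of_throughSplitAnchor_of_door_of_oneSplitWeilAnchorFieldChartCarriersAll h hT hall)

end Summit.HodgeConjecture.HodgeConjecture.Ring2.AbelianAll

end
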